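import Literature.Geometry.Kaehler.ComplexTorusLefschetzSL2ActionStrings
import HarnessLib

/-!
# Complete reducibility of Beauville's `SL₂(ℂ)`-action on `H•(X; ℂ)`: every `ρ(SL₂(ℂ))`-stable subspace has a
# `ρ(SL₂(ℂ))`-stable complement ("`CH(A)` is a direct sum of subrepresentations of this type")

Layer `Literature/Geometry/Kaehler`, namespace `Literature.Geometry.Kaehler.ComplexTorus`; lane `lit-hodgefound` (Track 2 foundations
library), prover seat `lit-hodgefound-p09` (generation 52, row g52-#12). THEOREMS ONLY (no definition, no named fact, no instance, no
notation; D-0026 net debt `0`). Assembly of row g21-#4 `GradedFormsLefschetzStrings` (`isSemisimpleModule_adjoin_lefschetz`: `H•(X; ℂ)` is a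
completely reducible module over the Lefschetz algebra `ℬ = ℂ[L_η, Λ_η, H]`, Goodman–Wallach Cor. 4.2.4) with row g52-#7
`ComplexTorusLefschetzSL2ActionStrings` (`forall_sl2Rep_apply_mem_iff_forall_mem_adjoin`: a `ℂ`-subspace is `ρ(SL₂(ℂ))`-stable iff it is `ℬ`-stable).

SETTING. `ρ = (hasLefschetzProperty_lefschetzG hη).sl2Rep isZGrading_countingG : SL(2, ℂ) →* End_ℂ(GForm E ℂ)` (`η` non-degenerate on `V = E`),
`ℬ = Algebra.adjoin ℂ {lefschetzG η, lefschetzDualG η, countingG E}` acting on `GForm E ℂ` through `End_ℂ`.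

## What is proved

* **`exists_lefschetz_stable_isCompl`**: a `ℂ`-subspace `U ⊆ H•(X; ℂ)` stable under `L_η` and `Λ_η` has a complement stable under `L_η` and `Λ_η`
  (the `ℬ`-submodule `U` has a `ℬ`-complement since `ℬ` acts semisimply; its underlying `ℂ`-subspace is the complement).
* **`exists_sl2Rep_stable_isCompl`: every `ρ(SL₂(ℂ))`-stable `ℂ`-subspace `U ⊆ H•(X; ℂ)` has a `ρ(SL₂(ℂ))`-stable complement `U'`,
  `U ⊕ U' = H•(X; ℂ)`** — the group-level complete reducibility behind "The vector space `CH(A)` is a direct sum of subrepresentations of this type".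

## Sources, VERBATIM

* A. Beauville, *The action of SL₂ on abelian varieties* (2010) [Beauville2010SL2], held text `paper:arxiv-0805.1541` p0006 L10–L13, §5 Proposition:
  "(`z, θz, …, θ^{g+s−2p} z`) is a basis of an irreducible subrepresentation of `CH(A)`. The vector space `CH(A)` is a direct sum of
  subrepresentations of this type."
* R. Goodman, N. R. Wallach, *Symmetry, Representations, and Invariants* (GTM 255, 2009) [GoodmanWallachGTM255], §4.2.1 Cor. 4.2.4 ("Then `L` is a
  completely reducible `ℬ`-module") and §4.1.4 Prop. 4.1.11 ("(1) `V` is completely reducible … (2) every `𝒜`-invariant subspace `W ⊂ V` has an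
  `𝒜`-invariant complement …").
* B. C. Hall, *Lie Groups, Lie Algebras, and Representations* (2nd ed., 2015) [Hall2015], Prop. 4.5 (invariant subspaces for a connected group and
  its Lie algebra).
-/

noncomputable section

-- `Module ℂ` / `SMulZeroClass ℂ` synthesis on `E [⋀^Fin k]→L[ℝ] ℂ` (as in `ComplexTorusLefschetzDecomposition`)
set_option maxSynthPendingDepth 3

namespace Literature.Geometry.Kaehler

namespace ComplexTorus

open Module Function Finset
open scoped MatrixGroups
open Literature.LinearAlgebra.Alternating Literature.Algebra.Lie

universe uE

variable {E : Type uE} [NormedAddCommGroup E] [NormedSpace ℂ E] [FiniteDimensional ℂ E] [Nontrivial E] {η : E [⋀^Fin 2]→L[ℝ] ℝ}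
  (hη : ∀ v : E, v ≠ 0 → ∃ w : E, η ![v, w] ≠ 0)
include hη

omit [Nontrivial E] in
/-- **A `ℂ`-subspace of `H•(X; ℂ)` stable under `L_η` and `Λ_η` has an `(L_η, Λ_η)`-stable complement**: `U` is a submodule over the Lefschetz
algebra `ℬ = ℂ[L_η, Λ_η, H]` (stability under `H` is automatic), `ℬ` acts completely reducibly (row g21-#4, Goodman–Wallach Cor. 4.2.4), and the
underlying `ℂ`-subspace of a `ℬ`-complement is the sought complement. [cite: GoodmanWallachGTM255, §4.2.1 Cor. 4.2.4 and §4.1.4 Prop. 4.1.11 (2)]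
[cite: HuybrechtsCG2005, §1.2 proof of Prop. 1.2.30 (i)] -/
theorem exists_lefschetz_stable_isCompl {U : Submodule ℂ (GForm E ℂ)} (hUL : ∀ u ∈ U, lefschetzG η u ∈ U)
    (hUΛ : ∀ u ∈ U, lefschetzDualG η u ∈ U) :
    ∃ U' : Submodule ℂ (GForm E ℂ), (∀ u ∈ U', lefschetzG η u ∈ U') ∧ (∀ u ∈ U', lefschetzDualG η u ∈ U') ∧ IsCompl U U' := by
  set B : Subalgebra ℂ (Module.End ℂ (GForm E ℂ)) := Algebra.adjoin ℂ {lefschetzG η, lefschetzDualG η, countingG E} with hB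
  haveI : IsSemisimpleModule B (GForm E ℂ) := isSemisimpleModule_adjoin_lefschetz hη
  -- `U` as a `ℬ`-submodule
  let UB : Submodule B (GForm E ℂ) :=
    { carrier := U
      add_mem' := fun hx hy ↦ U.add_mem hx hy
      zero_mem' := U.zero_mem
      smul_mem' := fun b x hx ↦ apply_mem_of_mem_adjoin_lefschetz_of_stable hη hUL hUΛ b.2 x hx }
  obtain ⟨VB, hVB⟩ := exists_isCompl UB
  -- the underlying `ℂ`-subspace of the `ℬ`-complement
  let U' : Submodule ℂ (GForm E ℂ) :=
    { carrier := VB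
      add_mem' := fun hx hy ↦ VB.add_mem hx hy
      zero_mem' := VB.zero_mem
      smul_mem' := fun c x hx ↦ by
        -- `c • x = (algebraMap ℂ ℬ c) • x`, and `VB` is a `ℬ`-submodule
        have h1 := VB.smul_mem (⟨algebraMap ℂ (Module.End ℂ (GForm E ℂ)) c, Subalgebra.algebraMap_mem B c⟩ : B) hx
        exact h1 }
  have hL : lefschetzG η ∈ B := Algebra.subset_adjoin (by simp)
  have hΛ : lefschetzDualG η ∈ B := Algebra.subset_adjoin (by simp)
  refine ⟨U', fun u hu ↦ VB.smul_mem ⟨lefschetzG η, hL⟩ (show u ∈ VB from hu),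
    fun u hu ↦ VB.smul_mem ⟨lefschetzDualG η, hΛ⟩ (show u ∈ VB from hu), ?_, ?_⟩
  · -- disjoint
    rw [Submodule.disjoint_def]
    intro x hxU hxU'
    have hx : x ∈ UB ⊓ VB := ⟨hxU, hxU'⟩
    rw [hVB.inf_eq_bot] at hx
    exact (Submodule.mem_bot B).1 hx
  · -- codisjoint
    rw [codisjoint_iff, eq_top_iff]
    intro x _
    have hx : x ∈ UB ⊔ VB := by rw [hVB.sup_eq_top]; exact Submodule.mem_top
    obtain ⟨u, hu, v, hv, rfl⟩ := Submodule.mem_sup.1 hx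
    exact Submodule.mem_sup.2 ⟨u, hu, v, hv, rfl⟩

/-- **COMPLETE REDUCIBILITY OF BEAUVILLE'S `SL₂(ℂ)`-ACTION: every `ρ(SL₂(ℂ))`-stable `ℂ`-subspace `U ⊆ H•(X; ℂ)` has a `ρ(SL₂(ℂ))`-stable
complement** (`ρ`-stable ⟺ `(L_η, Λ_η)`-stable, row g52-#7) — "The vector space `CH(A)` is a direct sum of subrepresentations of this type".
[cite: Beauville2010SL2, §5 Proposition (p. 6)] [cite: GoodmanWallachGTM255, §4.2.1 Cor. 4.2.4, §4.1.4 Prop. 4.1.11 (2)] [cite: Hall2015, Prop. 4.5] -/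
theorem exists_sl2Rep_stable_isCompl {U : Submodule ℂ (GForm E ℂ)}
    (hU : ∀ γ : SL(2, ℂ), ∀ u ∈ U, (hasLefschetzProperty_lefschetzG hη).sl2Rep isZGrading_countingG γ u ∈ U) :
    ∃ U' : Submodule ℂ (GForm E ℂ),
      (∀ γ : SL(2, ℂ), ∀ u ∈ U', (hasLefschetzProperty_lefschetzG hη).sl2Rep isZGrading_countingG γ u ∈ U') ∧ IsCompl U U' := by
  obtain ⟨hUL, hUΛ⟩ := (forall_sl2Rep_apply_mem_iff hη U).1 hU
  obtain ⟨U', hU'L, hU'Λ, hc⟩ := exists_lefschetz_stable_isCompl hη hUL hUΛ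
  exact ⟨U', (forall_sl2Rep_apply_mem_iff hη U').2 ⟨hU'L, hU'Λ⟩, hc⟩

/-- **Irreducible decomposition, inductive step**: a non-zero `ρ(SL₂(ℂ))`-stable subspace that is not all of `H•(X; ℂ)` splits `H•(X; ℂ)` into two
non-trivial `ρ(SL₂(ℂ))`-stable summands. [cite: Beauville2010SL2, §5 Proposition (p. 6)] [cite: GoodmanWallachGTM255, §4.1.4 Prop. 4.1.11] -/
theorem exists_sl2Rep_stable_isCompl_ne_bot {U : Submodule ℂ (GForm E ℂ)}
    (hU : ∀ γ : SL(2, ℂ), ∀ u ∈ U, (hasLefschetzProperty_lefschetzG hη).sl2Rep isZGrading_countingG γ u ∈ U) (hUtop : U ≠ ⊤) :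
    ∃ U' : Submodule ℂ (GForm E ℂ),
      (∀ γ : SL(2, ℂ), ∀ u ∈ U', (hasLefschetzProperty_lefschetzG hη).sl2Rep isZGrading_countingG γ u ∈ U') ∧ IsCompl U U' ∧ U' ≠ ⊥ := by
  obtain ⟨U', hU', hc⟩ := exists_sl2Rep_stable_isCompl hη hU
  refine ⟨U', hU', hc, fun h0 ↦ hUtop ?_⟩
  rw [← hc.sup_eq_top, h0, sup_bot_eq]

end ComplexTorus

end Literature.Geometry.Kaehler

end
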